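import Literature.Combinatorics.SimpleGraph.GraphRiemannRoch
import HarnessLib

/-!
# Baker–Norine's abstract Riemann–Roch criterion: for a degree-preserving congruence `∼` on
# `Div(X)`, the Riemann–Roch formula holds iff (RR1) and (RR2) (Baker–Norine 2007, Theorem 2.2)

Source (held, read at the page; statements VERBATIM). M. Baker, S. Norine, *Riemann–Roch and
Abel–Jacobi theory on a finite graph*, Adv. Math. 215 (2007) 766–788 [BakerNorine2007], §2 «A
Riemann–Roch criterion» (held text `paper:doi-10-1016-j-aim-2007-04-012` pp. 8–11): «Let `X` be a
non-empty set, and let `Div(X)` be the free abelian group on `X`. […] Let `∼` be an equivalence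
relation on `Div(X)` satisfying the following two properties: (E1) If `D ∼ D′` then
`deg(D) = deg(D′)`. (E2) If `D₁ ∼ D₁′` and `D₂ ∼ D₂′`, then `D₁ + D₁′ ∼ D₂ + D₂′`. For each
`D ∈ Div(X)`, define `|D| = {E ∈ Div(X) : E ≥ 0, E ∼ D}`, and define the function
`r : Div(X) → {−1, 0, 1, 2, …}` by declaring that for each integer `s ≥ 0`, `r(D) ≥ s ⟺
|D − E| ≠ ∅ ∀ E ∈ Div(X) : E ≥ 0 and deg(E) = s`. […] Let `g` be a nonnegative integer, and
define `𝒩 = {D ∈ Div(X) : deg(D) = g − 1 and |D| = ∅}`. Finally, let `K` be an element of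
`Div(X)` having degree `2g − 2`. […] **Theorem 2.2.** Define `ε : Div(X) → ℤ/2ℤ` by declaring that
`ε(D) = 0` if `|D| ≠ ∅` and `ε(D) = 1` if `|D| = ∅`. Then the Riemann–Roch formula (2.3)
`r(D) − r(K − D) = deg(D) + 1 − g` holds for all `D ∈ Div(X)` if and only if the following two
properties are satisfied: (RR1) For every `D ∈ Div(X)`, there exists `ν ∈ 𝒩` such that
`ε(D) + ε(ν − D) = 1`. (RR2) For every `D ∈ Div(X)` with `deg(D) = g − 1`, we have
`ε(D) + ε(K − D) = 0`. […] **Proof of Theorem 2.2.** We first prove that (2.3) implies (RR1) and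
(RR2). Let `D` be a divisor on `X`, and let `d = deg(D)`. Property (RR2) is more or less
immediate, since (2.3) implies that if `deg(D) = g − 1` then `r(D) = r(K − D)`. We cannot have
`ε(D) = ε(ν − D) = 0`, or else by Lemma 2.1 we would have `r(ν) ≥ 0`, contradicting the
definition of `𝒩`. As we will see in the next paragraph, `𝒩` is non-empty; therefore, to prove
(RR1) it suffices to show that if `r(D) = −1` then `r(ν − D) ≥ 0` for some `ν ∈ 𝒩`. If
`r(D + E) ≥ 0` for all `E ∈ Div₊^{g−1−d}(X)`, then (2.3) implies that `r(K − D − E) ≥ 0` for all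
such `E`, and therefore `r(K − D) ≥ g − 1 − d`. Another application of (2.3) then yields
`r(D) = r(K − D) + d + 1 − g ≥ 0`. Therefore when `r(D) = −1`, there exists an effective divisor
`E` of degree `g − 1 − d` such that `r(D + E) = −1`. Since `deg(D + E) = g − 1`, this means that
`D + E ∈ 𝒩` […] For this choice of `ν`, we have `r(ν − D) ≥ 0`, which proves (RR1). We now show
that (RR1) and (RR2) imply (2.3). Let `D ∈ Div(X)`. For every `ν ∈ 𝒩`, property (RR2) implies
that `ν̄ := K − ν` is also in `𝒩`. Writing `ν − D′ = K − D′ − ν̄`, it follows that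
`deg⁺(D′ − ν) − deg⁺((K − D′) − ν̄) = deg⁺(D′ − ν) − deg⁺(ν − D′) = deg(D′ − ν) = deg(D) + 1 − g`.
Since the difference […] has the constant value `deg(D) + 1 − g` for all `D′` and `ν`, and since
`ν̄ = K − ν` runs through all possible elements of `𝒩` as `ν` does, it follows from Lemmas 2.6 and
2.7 that `r(D) − r(K − D) = deg(D) + 1 − g` as desired.» (Lemma 2.7: «If (RR1) holds then for
every `D ∈ Div(X)` we have `r(D) = (min_{D′ ∼ D, ν ∈ 𝒩} deg⁺(D′ − ν)) − 1`.»)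

## What is formalised

`X` is a finite non-empty type (B–N: any non-empty set, divisors finitely supported —
`TODO(general form): Finsupp`). An equivalence relation on `Div(X) = X → ℤ` with (E2) is the
congruence of a subgroup `P ≤ Div(X)` («`D ∼ D′` iff `D − D′ ∈ P`»), and (E1) says that `P`
consists of divisors of degree `0` (hypothesis `hP`).

* `WinnableOf P D` (`|D| ≠ ∅`), `unwinnableDegreesOf`, **`rankOf P D`** (`r(D)`) with B–N's
  definition recovered as `rankOf_eq_neg_one_iff` / `le_rankOf_iff`, the API of §2's first
  paragraph («`r(D) = −1` if `deg(D) < 0`, and if `deg(D) = 0` then `r(D) = 0` if `D ∼ 0` and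
  `r(D) = −1` otherwise»: `rankOf_eq_neg_one_of_sum_neg`, `rankOf_eq_zero_of_mem`,
  `rankOf_eq_neg_one_of_sum_eq_zero`), **Lemma 2.1** in this generality
  (`rankOf_add_le_rankOf_add`), and `nonspecial P g` (`𝒩`);
* the graph case is an instance BY DEFINITION: `winnable_iff_winnableOf`, **`rank_eq_rankOf`**
  (`rank G D = rankOf (laplacianLattice G) D`, `rfl`);
* Lemma 2.7's two halves for abstract `𝒩`: `rankOf_le_sum_max_sub_one`,
  `exists_sum_max_le_rankOf_add_one` (under (RR1));
* **Theorem 2.2** **`riemannRoch_iff`**: `(∀ D, r(D) − r(K − D) = deg D + 1 − g) ↔ (RR1) ∧ (RR2)`,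
  with `ε(D) + ε(ν − D) = 1` rendered as `|D| ≠ ∅ ↔ |ν − D| = ∅` and `ε(D) + ε(K − D) = 0` as
  `|D| ≠ ∅ ↔ |K − D| ≠ ∅`;
* for graphs (Theorem 1.12 in the tree): **`graph_rr1`** — (RR1) holds for linear equivalence on
  a connected graph with `𝒩` the unwinnable divisors of degree `g − 1` ((RR2) is
  `winnable_iff_winnable_canonical_sub` of `GraphRiemannRoch`).

Definitions with bodies and theorems; no `sorry`; no named facts.
-/

open Finset SimpleGraph Matrix
open Literature.Combinatorics.SimpleGraph.ChipFiring

namespace Literature.Combinatorics.SimpleGraph.BakerNorine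

/-! ### §1 `|D|`, `r(D)` and `𝒩` for a congruence on `Div(X)` -/

section Abstract

variable {X : Type*} [Fintype X] (P : AddSubgroup (X → ℤ))

/-- `|D| ≠ ∅` for the congruence of `P`: `D ∼ E` for some effective `E` («`|D| = {E ∈ Div(X) :
E ≥ 0, E ∼ D}`»). [cite: BakerNorine2007, §2 (setup before Lemma 2.1)] -/
def WinnableOf (D : X → ℤ) : Prop := ∃ E : X → ℤ, 0 ≤ E ∧ D - E ∈ P

/-- The degrees of the effective `E` with `|D − E| = ∅`. [cite: BakerNorine2007, §2] -/
def unwinnableDegreesOf (D : X → ℤ) : Set ℕ :=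
  {n | ∃ E : X → ℤ, 0 ≤ E ∧ ∑ x, E x = n ∧ ¬WinnableOf P (D - E)}

/-- **`r(D)`** for the congruence of `P`: «`r(D) ≥ s ⟺ |D − E| ≠ ∅ ∀ E ∈ Div(X) : E ≥ 0 and
deg(E) = s`», `r(D) = −1` iff `|D| = ∅`. [cite: BakerNorine2007, §2] -/
noncomputable def rankOf (D : X → ℤ) : ℤ := (sInf (unwinnableDegreesOf P D) : ℕ) - 1

/-- **`𝒩 = {D ∈ Div(X) : deg(D) = g − 1 and |D| = ∅}`.** [cite: BakerNorine2007, §2] -/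
def nonspecial (g : ℕ) : Set (X → ℤ) := {D | ∑ x, D x = (g : ℤ) - 1 ∧ ¬WinnableOf P D}

variable {P}

omit [Fintype X] in
/-- Effective divisors have `|D| ≠ ∅`. [cite: BakerNorine2007, §2] -/
theorem winnableOf_of_nonneg {D : X → ℤ} (h : 0 ≤ D) : WinnableOf P D :=
  ⟨D, h, by rw [sub_self]; exact zero_mem P⟩

omit [Fintype X] in
/-- `|D|` depends only on the class of `D`. [cite: BakerNorine2007, §2 (E2)] -/
theorem WinnableOf.congr {D D' : X → ℤ} (h : D - D' ∈ P) (hD : WinnableOf P D) : WinnableOf P D' := by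
  obtain ⟨E, hE, hDE⟩ := hD
  refine ⟨E, hE, ?_⟩
  have := sub_mem hDE h
  rwa [sub_sub_sub_cancel_left] at this

omit [Fintype X] in
/-- (E2): `|D| ≠ ∅` and `|D′| ≠ ∅` give `|D + D′| ≠ ∅`. [cite: BakerNorine2007, Lemma 2.1 (proof)] -/
theorem WinnableOf.add {D D' : X → ℤ} (h : WinnableOf P D) (h' : WinnableOf P D') :
    WinnableOf P (D + D') := by
  obtain ⟨E, hE, hDE⟩ := h
  obtain ⟨E', hE', hDE'⟩ := h'
  refine ⟨E + E', add_nonneg hE hE', ?_⟩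
  rw [add_sub_add_comm]
  exact add_mem hDE hDE'

omit [Fintype X] in
/-- Adding an effective divisor. [cite: BakerNorine2007, Lemma 2.1 (proof)] -/
theorem WinnableOf.add_nonneg {D F : X → ℤ} (h : WinnableOf P D) (hF : 0 ≤ F) : WinnableOf P (D + F) :=
  h.add (winnableOf_of_nonneg hF)

/-- (E1): for a degree-`0` subgroup, `|D| ≠ ∅` forces `deg D ≥ 0`. [cite: BakerNorine2007, §2
(«`r(D) = −1` if `deg(D) < 0`»)] -/
theorem WinnableOf.sum_nonneg (hP : ∀ D ∈ P, ∑ x, D x = 0) {D : X → ℤ} (h : WinnableOf P D) :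
    0 ≤ ∑ x, D x := by
  obtain ⟨E, hE, hDE⟩ := h
  have h0 := hP _ hDE
  simp only [Pi.sub_apply, Finset.sum_sub_distrib] at h0
  have : 0 ≤ ∑ x, E x := Finset.sum_nonneg fun x _ => hE x
  linarith

/-- A single point carrying `c ≥ 0` is effective of degree `c`. [folklore] -/
private theorem single_nonneg_sum' [DecidableEq X] (v : X) {c : ℤ} (hc : 0 ≤ c) :
    (0 : X → ℤ) ≤ Pi.single v c ∧ ∑ u, Pi.single v c u = c := by
  refine ⟨fun u => ?_, by rw [Finset.sum_pi_single', if_pos (mem_univ v)]⟩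
  by_cases hu : u = v
  · subst hu
    rw [Pi.single_eq_same]
    exact hc
  · rw [Pi.zero_apply, Pi.single_eq_of_ne hu]

/-- The auxiliary set is non-empty when `P` has degree `0`. [cite: BakerNorine2007, §2] -/
theorem unwinnableDegreesOf_nonempty (hP : ∀ D ∈ P, ∑ x, D x = 0) [Nonempty X] (D : X → ℤ) :
    (unwinnableDegreesOf P D).Nonempty := by
  classical
  obtain ⟨v⟩ := ‹Nonempty X›
  obtain ⟨h0, hs⟩ := single_nonneg_sum' v (c := (((∑ u, D u).toNat + 1 : ℕ) : ℤ)) (by positivity)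
  refine ⟨(∑ u, D u).toNat + 1, Pi.single v _, h0, hs, fun hW => ?_⟩
  have h1 := hW.sum_nonneg hP
  simp only [Pi.sub_apply, Finset.sum_sub_distrib, hs] at h1
  have := Int.self_le_toNat (∑ u, D u)
  push_cast at h1
  omega

variable (P) in
/-- `r(D) ≥ −1`. [cite: BakerNorine2007, §2] -/
theorem neg_one_le_rankOf (D : X → ℤ) : -1 ≤ rankOf P D := by
  unfold rankOf
  omega

/-- «`r(D) = −1` if `|D| = ∅`» (and only then). [cite: BakerNorine2007, §2] -/
theorem rankOf_eq_neg_one_iff (hP : ∀ D ∈ P, ∑ x, D x = 0) [Nonempty X] (D : X → ℤ) :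
    rankOf P D = -1 ↔ ¬WinnableOf P D := by
  have key : sInf (unwinnableDegreesOf P D) = 0 ↔ ¬WinnableOf P D := by
    rw [Nat.sInf_eq_zero, or_iff_left (unwinnableDegreesOf_nonempty hP D).ne_empty]
    constructor
    · rintro ⟨E, hE, hs, hw⟩
      have hs0 : ∑ v, E v = 0 := by exact_mod_cast hs
      obtain rfl : E = 0 :=
        funext fun v => (Finset.sum_eq_zero_iff_of_nonneg fun v _ => hE v).1 hs0 v (mem_univ v)
      rwa [sub_zero] at hw
    · intro hw
      exact ⟨0, le_rfl, by simp, by rwa [sub_zero]⟩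
  rw [← key]
  unfold rankOf
  omega

/-- `r(D) ≥ 0` iff `|D| ≠ ∅`. [cite: BakerNorine2007, §2] -/
theorem rankOf_nonneg_iff (hP : ∀ D ∈ P, ∑ x, D x = 0) [Nonempty X] (D : X → ℤ) :
    0 ≤ rankOf P D ↔ WinnableOf P D := by
  have h1 := neg_one_le_rankOf P D
  have h2 := rankOf_eq_neg_one_iff hP D
  constructor
  · intro h
    by_contra hw
    have := h2.2 hw
    omega
  · intro hw
    by_contra h
    exact h2.1 (by omega) hw

/-- **B–N's definition of `r`**: «for each integer `s ≥ 0`, `r(D) ≥ s ⟺ |D − E| ≠ ∅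
∀ E ∈ Div(X) : E ≥ 0 and deg(E) = s`». [cite: BakerNorine2007, §2] -/
theorem le_rankOf_iff (hP : ∀ D ∈ P, ∑ x, D x = 0) [Nonempty X] (D : X → ℤ) (s : ℕ) :
    (s : ℤ) ≤ rankOf P D ↔ ∀ E : X → ℤ, 0 ≤ E → ∑ v, E v = s → WinnableOf P (D - E) := by
  classical
  have hne := unwinnableDegreesOf_nonempty hP D
  constructor
  · intro h E hE hs
    by_contra hw
    have := Nat.sInf_le (show s ∈ unwinnableDegreesOf P D from ⟨E, hE, hs, hw⟩)
    unfold rankOf at h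
    omega
  · intro h
    unfold rankOf
    suffices hlt : s < sInf (unwinnableDegreesOf P D) by omega
    by_contra hge
    push Not at hge
    obtain ⟨E, hE, hs, hw⟩ := Nat.sInf_mem hne
    obtain ⟨v⟩ := ‹Nonempty X›
    obtain ⟨h0, hs'⟩ :=
      single_nonneg_sum' v (c := (s : ℤ) - sInf (unwinnableDegreesOf P D)) (by omega)
    apply hw
    have hw' := h (E + Pi.single v ((s : ℤ) - sInf (unwinnableDegreesOf P D)))
      (add_nonneg hE h0)
      (by simp only [Pi.add_apply, Finset.sum_add_distrib]; rw [hs, hs']; omega)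
    have : D - E = D - (E + Pi.single v ((s : ℤ) - sInf (unwinnableDegreesOf P D)))
        + Pi.single v ((s : ℤ) - sInf (unwinnableDegreesOf P D)) := by abel
    rw [this]
    exact hw'.add_nonneg h0

/-- `r(D) < s` iff some effective `E` of degree `s` has `|D − E| = ∅`. [cite: BakerNorine2007, §2] -/
theorem rankOf_lt_iff (hP : ∀ D ∈ P, ∑ x, D x = 0) [Nonempty X] (D : X → ℤ) (s : ℕ) :
    rankOf P D < s ↔ ∃ E : X → ℤ, 0 ≤ E ∧ ∑ v, E v = s ∧ ¬WinnableOf P (D - E) := by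
  rw [← not_le, le_rankOf_iff hP]
  push Not
  rfl

/-- «It is easy to see that `r(D) = −1` if `deg(D) < 0`» (abstract setting: `P` consists of
divisors of degree zero). [cite: BakerNorine2007, §2] -/
theorem rankOf_eq_neg_one_of_sum_neg (hP : ∀ D ∈ P, ∑ x, D x = 0) [Nonempty X] {D : X → ℤ}
    (h : ∑ x, D x < 0) : rankOf P D = -1 := by
  rw [rankOf_eq_neg_one_iff hP]
  intro hw
  have := hw.sum_nonneg hP
  omega

/-- «if `deg(D) = 0` then `r(D) = 0` if `D ∼ 0`» (abstract setting). [cite: BakerNorine2007, §2] -/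
theorem rankOf_eq_zero_of_mem (hP : ∀ D ∈ P, ∑ x, D x = 0) [Nonempty X] {D : X → ℤ}
    (h : D ∈ P) : rankOf P D = 0 := by
  classical
  have h0 : 0 ≤ rankOf P D :=
    (rankOf_nonneg_iff hP D).2 ⟨0, le_rfl, by rwa [sub_zero]⟩
  have h1 : rankOf P D < (1 : ℕ) := by
    rw [rankOf_lt_iff hP]
    obtain ⟨x⟩ := ‹Nonempty X›
    refine ⟨Pi.single x 1, fun y => ?_, by simp, fun hw => ?_⟩
    · by_cases hy : y = x
      · rw [hy, Pi.single_eq_same]; exact zero_le_one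
      · rw [Pi.single_eq_of_ne hy]; exact le_rfl
    · have hs := hw.sum_nonneg hP
      simp only [Pi.sub_apply, Finset.sum_sub_distrib, Finset.sum_pi_single', mem_univ,
        if_true, hP D h] at hs
      omega
  simp only [Nat.cast_one] at h1
  omega

/-- «if `deg(D) = 0` then […] `r(D) = −1` otherwise» (i.e. when `D ≁ 0`; abstract setting).
[cite: BakerNorine2007, §2] -/
theorem rankOf_eq_neg_one_of_sum_eq_zero (hP : ∀ D ∈ P, ∑ x, D x = 0) [Nonempty X] {D : X → ℤ}
    (h0 : ∑ x, D x = 0) (h : D ∉ P) : rankOf P D = -1 := by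
  rw [rankOf_eq_neg_one_iff hP]
  rintro ⟨E, hE, hDE⟩
  -- `deg E = deg D = 0` and `E ≥ 0` force `E = 0`, so `D ∈ P`
  have hs := hP _ hDE
  simp only [Pi.sub_apply, Finset.sum_sub_distrib, h0, zero_sub, neg_eq_zero] at hs
  have hE0 : E = 0 := by
    funext x
    have hx := (Finset.sum_eq_zero_iff_of_nonneg fun y _ => hE y).1 hs x (mem_univ x)
    exact hx
  rw [hE0, sub_zero] at hDE
  exact h hDE

/-- **Lemma 2.1** (in the abstract setting of §2). «For all `D, D′ ∈ Div(X)` such that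
`r(D), r(D′) ≥ 0`, we have `r(D + D′) ≥ r(D) + r(D′)`.» [cite: BakerNorine2007, Lemma 2.1] -/
theorem rankOf_add_le_rankOf_add [DecidableEq X] (hP : ∀ D ∈ P, ∑ x, D x = 0) [Nonempty X]
    {D D' : X → ℤ} (hD : 0 ≤ rankOf P D) (hD' : 0 ≤ rankOf P D') :
    rankOf P D + rankOf P D' ≤ rankOf P (D + D') := by
  obtain ⟨s, hs⟩ := Int.eq_ofNat_of_zero_le hD
  obtain ⟨s', hs'⟩ := Int.eq_ofNat_of_zero_le hD'
  rw [hs, hs', ← Nat.cast_add, le_rankOf_iff hP]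
  intro E₀ hE₀ hsum
  -- split `E₀ = E + (E₀ − E)` with `deg E = r(D)` and `deg (E₀ − E) = r(D′)`
  obtain ⟨E, hE, hEE₀, hEs⟩ := exists_le_sum_eq hE₀ (a := s) (by rw [hsum]; push_cast; omega)
  have h1 := (le_rankOf_iff hP D s).1 hs.symm.le E hE hEs
  have h2 := (le_rankOf_iff hP D' s').1 hs'.symm.le (E₀ - E) (sub_nonneg.2 hEE₀) (by
    simp only [Pi.sub_apply, Finset.sum_sub_distrib, hsum, hEs]; push_cast; ring)
  have h := h1.add h2
  have heq : D - E + (D' - (E₀ - E)) = D + D' - E₀ := by abel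
  rwa [heq] at h

end Abstract

/-! ### §2 The graph case is the case `P = Prin(G)` -/

section Graph

variable {V : Type*} [Fintype V] [DecidableEq V] (G : SimpleGraph V) [DecidableRel G.Adj]

/-- For `P = Prin(G) = 𝓛(Q)`, `|D| ≠ ∅` is the graph notion. [cite: BakerNorine2007, §1.6 and §2] -/
theorem winnable_iff_winnableOf (D : V → ℤ) : Winnable G D ↔ WinnableOf (laplacianLattice G) D :=
  Iff.rfl

/-- For `P = Prin(G)`, `r(D)` is the graph notion (definitionally). [cite: BakerNorine2007, §1.6 and §2] -/
theorem rank_eq_rankOf (D : V → ℤ) : rank G D = rankOf (laplacianLattice G) D := rfl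

/-- `Prin(G)` has degree `0` (hypothesis (E1)). [cite: BakerNorine2007, §1.3 («every principal
divisor has degree zero»)] -/
theorem laplacianLattice_sum_eq_zero (D : V → ℤ) (hD : D ∈ laplacianLattice G) : ∑ v, D v = 0 :=
  (mem_zeroSumLattice_iff D).1 (laplacianLattice_le_zeroSumLattice G hD)

end Graph

/-! ### §3 Lemma 2.7 for abstract `𝒩`, and Theorem 2.2 -/

section Criterion

variable {X : Type*} [Fintype X] {P : AddSubgroup (X → ℤ)}

/-- **Lemma 2.7 (`≤`).** For `D − D′ ∈ P` and `ν ∈ 𝒩`: `r(D) ≤ deg⁺(D′ − ν) − 1` («`D − E ∼ ν − E′`,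
and since `ν − E′` is not equivalent to any effective divisor, `|D − E| = ∅`»).
[cite: BakerNorine2007, Lemma 2.7] -/
theorem rankOf_le_sum_max_sub_one (hP : ∀ D ∈ P, ∑ x, D x = 0) [Nonempty X] {g : ℕ}
    {D D' ν : X → ℤ} (h : D - D' ∈ P) (hν : ν ∈ nonspecial P g) :
    rankOf P D ≤ (∑ x, max ((D' - ν) x) 0) - 1 := by
  have hE : (0 : X → ℤ) ≤ fun x => max ((D' - ν) x) 0 := fun x => le_max_right _ _
  obtain ⟨s, hs⟩ := Int.eq_ofNat_of_zero_le
    (Finset.sum_nonneg fun x (_ : x ∈ univ) => hE x : (0 : ℤ) ≤ ∑ x, max ((D' - ν) x) 0)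
  have hlt : rankOf P D < s := by
    rw [rankOf_lt_iff hP]
    refine ⟨fun x => max ((D' - ν) x) 0, hE, hs, fun hW => hν.2 ?_⟩
    have hE' : (0 : X → ℤ) ≤ (fun x => max ((D' - ν) x) 0) - (D' - ν) := fun x => by
      rw [Pi.zero_apply, Pi.sub_apply]
      exact sub_nonneg.2 (le_max_left _ _)
    have h1 : (D - fun x => max ((D' - ν) x) 0) - (D' - fun x => max ((D' - ν) x) 0) ∈ P := by
      rwa [sub_sub_sub_cancel_right]
    have key := ((WinnableOf.congr h1) hW).add_nonneg hE'
    have heq : D' - (fun x => max ((D' - ν) x) 0)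
        + ((fun x => max ((D' - ν) x) 0) - (D' - ν)) = ν := by abel
    rwa [heq] at key
  linarith

/-- **Lemma 2.7 (`≥`) under (RR1).** Some `D′` with `D − D′ ∈ P` and `ν ∈ 𝒩` have
`deg⁺(D′ − ν) ≤ r(D) + 1` («By (RR1), […] there exists a divisor `ν ∈ 𝒩` and an effective divisor
`E′` such that `ν − D + E ∼ E′`. But then `D′ − ν = E − E′` for some divisor `D′ ∼ D`»).
[cite: BakerNorine2007, Lemma 2.7] -/
theorem exists_sum_max_le_rankOf_add_one (hP : ∀ D ∈ P, ∑ x, D x = 0) [Nonempty X] {g : ℕ}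
    (rr1 : ∀ D : X → ℤ, ∃ ν ∈ nonspecial P g, (WinnableOf P D ↔ ¬WinnableOf P (ν - D)))
    (D : X → ℤ) :
    ∃ D' ν : X → ℤ, D - D' ∈ P ∧ ν ∈ nonspecial P g ∧
      (∑ x, max ((D' - ν) x) 0) ≤ rankOf P D + 1 := by
  have hr := neg_one_le_rankOf P D
  obtain ⟨s, hs⟩ := Int.eq_ofNat_of_zero_le (show 0 ≤ rankOf P D + 1 by omega)
  obtain ⟨E, hE, hEs, hW⟩ := (rankOf_lt_iff hP D s).1 (by omega)
  obtain ⟨ν, hν, hiff⟩ := rr1 (D - E)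
  have hW' : WinnableOf P (ν - (D - E)) := by
    by_contra h'
    exact hW (hiff.2 h')
  obtain ⟨E', hE', hmem⟩ := hW'
  refine ⟨ν + E - E', ν, ?_, hν, ?_⟩
  · have := neg_mem hmem
    have heq : D - (ν + E - E') = -(ν - (D - E) - E') := by abel
    rwa [heq]
  · rw [hs, ← hEs]
    refine Finset.sum_le_sum fun x _ => ?_
    have h1 : (0 : ℤ) ≤ E x := hE x
    have h2 : (0 : ℤ) ≤ E' x := hE' x
    simp only [Pi.sub_apply, Pi.add_apply]
    omega

/-- **Theorem 2.2 (abstract Riemann–Roch criterion).** For the congruence of a degree-`0` subgroup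
`P ≤ Div(X)` (`X` finite non-empty), `g ≥ 0` and `K` of degree `2g − 2`: «the Riemann–Roch
formula (2.3) `r(D) − r(K − D) = deg(D) + 1 − g` holds for all `D ∈ Div(X)` if and only if» (RR1)
«for every `D ∈ Div(X)`, there exists `ν ∈ 𝒩` such that `ε(D) + ε(ν − D) = 1`» (exactly one of
`|D|`, `|ν − D|` is non-empty) and (RR2) «for every `D ∈ Div(X)` with `deg(D) = g − 1`, we have
`ε(D) + ε(K − D) = 0`» (`|D| ≠ ∅ ⟺ |K − D| ≠ ∅`). [cite: BakerNorine2007, Theorem 2.2] -/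
theorem riemannRoch_iff [DecidableEq X] (hP : ∀ D ∈ P, ∑ x, D x = 0) [Nonempty X] (g : ℕ)
    (K : X → ℤ) (hK : ∑ x, K x = 2 * (g : ℤ) - 2) :
    (∀ D : X → ℤ, rankOf P D - rankOf P (K - D) = ∑ x, D x + 1 - g) ↔
      (∀ D : X → ℤ, ∃ ν ∈ nonspecial P g, (WinnableOf P D ↔ ¬WinnableOf P (ν - D))) ∧
        (∀ D : X → ℤ, ∑ x, D x = (g : ℤ) - 1 → (WinnableOf P D ↔ WinnableOf P (K - D))) := by
  constructor
  · intro hRR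
    -- (RR2) «is more or less immediate»
    have rr2 : ∀ D : X → ℤ, ∑ x, D x = (g : ℤ) - 1 → (WinnableOf P D ↔ WinnableOf P (K - D)) := by
      intro D hD
      have h := hRR D
      rw [← rankOf_nonneg_iff hP, ← rankOf_nonneg_iff hP]
      omega
    -- the key step: `r(D) = −1` forces some `ν = D + E ∈ 𝒩` with `E` effective
    have key : ∀ D : X → ℤ, ¬WinnableOf P D →
        ∃ E : X → ℤ, 0 ≤ E ∧ D + E ∈ nonspecial P g := by
      intro D hD
      have hr : rankOf P D = -1 := (rankOf_eq_neg_one_iff hP D).2 hD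
      have hdeg : ∑ x, D x ≤ (g : ℤ) - 1 := by
        have h := hRR D
        have h' := neg_one_le_rankOf P (K - D)
        omega
      obtain ⟨k, hk⟩ := Int.eq_ofNat_of_zero_le (show (0 : ℤ) ≤ (g : ℤ) - 1 - ∑ x, D x by omega)
      -- «If `r(D + E) ≥ 0` for all `E ∈ Div₊^{g−1−d}(X)`, then […] `r(K − D) ≥ g − 1 − d` […]
      -- `r(D) ≥ 0`»: so some such `E` has `|D + E| = ∅`
      by_contra hcon
      push Not at hcon
      have hKD : (k : ℤ) ≤ rankOf P (K - D) := by
        rw [le_rankOf_iff hP]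
        intro E hE hEk
        have hnsp : ¬(D + E ∈ nonspecial P g) := hcon E hE
        have hdegDE : ∑ x, (D + E) x = (g : ℤ) - 1 := by
          simp only [Pi.add_apply, Finset.sum_add_distrib, hEk]
          omega
        have hWDE : WinnableOf P (D + E) := by
          by_contra hW
          exact hnsp ⟨hdegDE, hW⟩
        have := (rr2 (D + E) hdegDE).1 hWDE
        rwa [← sub_sub] at this
      have h := hRR D
      omega
    -- `𝒩 ≠ ∅`: apply the key step to a divisor of negative degree
    obtain ⟨v⟩ := ‹Nonempty X›
    have hN : ∃ ν, ν ∈ nonspecial P g := by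
      obtain ⟨h0, hs⟩ := single_nonneg_sum' v (c := (1 : ℤ)) zero_le_one
      have hW : ¬WinnableOf P (-Pi.single v 1) := fun hW => by
        have := hW.sum_nonneg hP
        simp only [Pi.neg_apply, Finset.sum_neg_distrib, hs] at this
        omega
      obtain ⟨E, -, hE⟩ := key _ hW
      exact ⟨_, hE⟩
    refine ⟨fun D => ?_, rr2⟩
    by_cases hD : WinnableOf P D
    · -- any `ν ∈ 𝒩` works: «we cannot have `ε(D) = ε(ν − D) = 0`»
      obtain ⟨ν, hν⟩ := hN
      refine ⟨ν, hν, iff_of_true hD fun hνD => hν.2 ?_⟩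
      have := hD.add hνD
      rwa [add_sub_cancel] at this
    · obtain ⟨E, hE, hDE⟩ := key D hD
      refine ⟨D + E, hDE, iff_of_false hD (not_not.2 ?_)⟩
      rw [add_sub_cancel_left]
      exact winnableOf_of_nonneg hE
  · rintro ⟨rr1, rr2⟩
    -- (RR2): `ν̄ := K − ν ∈ 𝒩` for `ν ∈ 𝒩`
    have hbar : ∀ ν ∈ nonspecial P g, K - ν ∈ nonspecial P g := by
      rintro ν ⟨hdeg, hW⟩
      have hdeg' : ∑ x, (K - ν) x = (g : ℤ) - 1 := by
        simp only [Pi.sub_apply, Finset.sum_sub_distrib, hK, hdeg]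
        ring
      refine ⟨hdeg', fun hW' => hW ?_⟩
      have := (rr2 (K - ν) hdeg').1 hW'
      rwa [sub_sub_cancel] at this
    -- one-sided inequality from Lemma 2.7, for every `D`
    have half : ∀ D : X → ℤ, rankOf P (K - D) - rankOf P D ≤ (g : ℤ) - 1 - ∑ x, D x := by
      intro D
      obtain ⟨D', ν, hDD', hν, hle⟩ := exists_sum_max_le_rankOf_add_one hP rr1 D
      have hA := rankOf_le_sum_max_sub_one hP (g := g) (D := K - D) (D' := K - D') (ν := K - ν)
        (by have heq : K - D - (K - D') = -(D - D') := by abel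
            rw [heq]; exact neg_mem hDD') (hbar ν hν)
      have heq : K - D' - (K - ν) = -(D' - ν) := by abel
      rw [heq] at hA
      have hd := sum_max_sub_sum_max_neg (D' - ν)
      have hsum : ∑ x, (D' - ν) x = ∑ x, D x - ((g : ℤ) - 1) := by
        have h0 := hP _ hDD'
        simp only [Pi.sub_apply, Finset.sum_sub_distrib, hν.1] at h0 ⊢
        linarith
      rw [hsum] at hd
      linarith
    intro D
    have h1 := half D
    have h2 := half (K - D)
    rw [sub_sub_cancel] at h2
    simp only [Pi.sub_apply, Finset.sum_sub_distrib, hK] at h2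
    omega

end Criterion

/-! ### §4 (RR1) and (RR2) for graphs -/

section GraphRR

variable {V : Type*} [Fintype V] [DecidableEq V] {G : SimpleGraph V} [DecidableRel G.Adj]

/-- For a connected graph (where Theorem 1.12 holds) the criterion yields **(RR1)**: for every
`D` there is an unwinnable `ν` of degree `g − 1` with exactly one of `|D|`, `|ν − D|` non-empty.
[cite: BakerNorine2007, Theorem 2.2 with Theorem 1.12] -/
theorem graph_rr1 (hG : G.Connected) (D : V → ℤ) :
    ∃ ν : V → ℤ, (∑ v, ν v = genus G - 1 ∧ ¬Winnable G ν) ∧ (Winnable G D ↔ ¬Winnable G (ν - D)) := by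
  haveI : Nonempty V := hG.nonempty
  obtain ⟨g, hg⟩ := Int.eq_ofNat_of_zero_le (genus_nonneg G hG)
  have hRR : ∀ D : V → ℤ, rankOf (laplacianLattice G) D - rankOf (laplacianLattice G)
      (canonicalDivisor G - D) = ∑ x, D x + 1 - g := by
    intro D'
    rw [← rank_eq_rankOf, ← rank_eq_rankOf, rank_sub_rank_canonical_sub hG, hg]
  obtain ⟨rr1, -⟩ := (riemannRoch_iff (laplacianLattice_sum_eq_zero G) g (canonicalDivisor G)
    (by rw [sum_canonicalDivisor, hg])).1 hRR
  obtain ⟨ν, ⟨hdeg, hW⟩, hiff⟩ := rr1 D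
  exact ⟨ν, ⟨by rw [hdeg, hg], hW⟩, hiff⟩

end GraphRR

end Literature.Combinatorics.SimpleGraph.BakerNorine
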